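import Literature.NumberTheory.Automorphic.ArchDistributionOneParamDeriv
import Literature.NumberTheory.Automorphic.ArchRankinSelbergOfTorusKirillov
import HarnessLib

/-!
# Left translates `T ∘ λ(w)` of distributions on `GL_n(K_∞)`

Topic `NumberTheory/Automorphic`; namespace `Literature.NumberTheory.Automorphic`. For a linear functional
`T` on `C_c^∞(G_∞)`, `G_∞ = GL_n(K_∞)`, and `w ∈ G_∞`, the translate `T ∘ λ(w)` (`λ(w) f = f(w⁻¹ ·)`,
`archTestFunctions.leftTranslate`) inherits the structure used in the Gelfand–Kazhdan analysis:

* `isArchDistribution_comp_leftTranslate`: `T ∘ λ(w)` is a distribution (`IsArchDistribution`) when `T` is —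
  the seminorms transform by `L_u R_v (λ(w) f) = λ(w) (L_{Ad(w⁻¹) u} R_v f)`
  (`archLeftWordDeriv_archRightWordDeriv_comp_mul_left`, from the tree's `archLeftWordDeriv_comp_mul_left`);
* `rightDeriv_leftTranslate`, `leftDeriv_leftTranslate`: `R_X λ(w) = λ(w) R_X`, `L_X λ(w) = λ(w) L_{w⁻¹ X w}`;
  the right-form Casimir operators commute with `λ(w)` (`placeCasimirRealR_leftTranslate`, …), so
  `T ∘ λ(w)` is a Casimir eigendistribution when `T` is (`IsArchCasimirEigendistribution.comp_leftTranslate`);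
* quasi-invariance: `T ∘ λ(w)` is right `(N, ψ_∞⁻¹)`-quasi-invariant when `T` is
  (`apply_rightTranslate_comp_leftTranslate`), hence `(T ∘ λ(w))(R_{x E_{ij}} f) = -ψ'_∞(x E_{ij}) (T ∘ λ(w)) f`;
  and for `Y` with `w Y w⁻¹ = x E_{ij}`, `i < j`, a left `(N, ψ_∞)`-quasi-invariant `T` gives
  `(T ∘ λ(w))(L_Y f) = ψ'_∞(x E_{ij}) (T ∘ λ(w)) f` (`apply_leftDeriv_comp_leftTranslate`).

These are the equations satisfied by a bi-quasi-invariant distribution viewed in a translated chart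
`w · N w⁰ A N` (Shalika 1974, §2). Everything is proved; no named fact is introduced.

## References

* J. A. Shalika, *The multiplicity one theorem for `GL_n`*, Ann. of Math. 100 (1974), §2. [Shalika1974]
-/

noncomputable section

open MeasureTheory Measure NumberField NumberField.mixedEmbedding NumberField.InfinitePlace IsDedekindDomain Set Filter
open scoped MatrixGroups Topology Classical ContDiff Matrix.Norms.Operator ComplexConjugate

namespace Literature.NumberTheory.Automorphic

variable {n : ℕ} {K : Type} [Field K] [NumberField K]

attribute [local instance] glInfBorel borelSpace_glInf locallyCompactSpace_glInf
  secondCountableTopology_glInf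

-- Mathlib idiom (Mathlib/Algebra/Lie/OfAssociative.lean): the commutator Lie ring on matrices
attribute [local instance 100] LieRing.ofAssociativeRing

-- as in `ArchGardingWhittaker`: the scoped `L∞`-operator normed ring structure on matrices is only
-- reducibly defeq to the Pi uniformity
set_option backward.isDefEq.respectTransparency false

local notation "Mat" => Matrix (Fin n) (Fin n) (mixedSpace K)
local notation "G∞" => GL (Fin n) (mixedSpace K)
local notation "R∞" => mixedSpace K

/-! ### 1. Words of invariant derivatives of a left translate -/

section Words

omit [NumberField K] in
/-- `Ad(g) X = g X g⁻¹`. [folklore] -/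
def adConjGL (g : G∞) (X : Mat) : Mat := (g : Mat) * X * ((g⁻¹ : G∞) : Mat)

omit [NumberField K] in
/-- Unfolding `adConjGL`. [folklore] -/
theorem adConjGL_apply (g : G∞) (X : Mat) : adConjGL g X = (g : Mat) * X * ((g⁻¹ : G∞) : Mat) := rfl

omit [NumberField K] in
/-- `Ad(g) (Ad(g⁻¹) X) = X`. [folklore] -/
theorem adConjGL_adConjGL_inv (g : G∞) (X : Mat) : adConjGL g (adConjGL g⁻¹ X) = X := by
  simp only [adConjGL_apply, inv_inv]
  rw [show (g : Mat) * (((g⁻¹ : G∞) : Mat) * X * (g : Mat)) * ((g⁻¹ : G∞) : Mat) =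
      ((g : Mat) * ((g⁻¹ : G∞) : Mat)) * X * ((g : Mat) * ((g⁻¹ : G∞) : Mat)) by noncomm_ring,
    ← Units.val_mul, mul_inv_cancel, Units.val_one, Matrix.one_mul, Matrix.mul_one]

omit [NumberField K] in
/-- `Ad(g⁻¹) (Ad(g) X) = X`. [folklore] -/
theorem adConjGL_inv_adConjGL (g : G∞) (X : Mat) : adConjGL g⁻¹ (adConjGL g X) = X := by
  have := adConjGL_adConjGL_inv g⁻¹ X
  rwa [inv_inv] at this

omit [NumberField K] in
/-- The conjugation map of `archLeftWordDeriv_comp_mul_left` is `adConjGL g`. [folklore] -/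
theorem adConjGL_eq (g : G∞) : (fun X : Mat => (g : Mat) * X * ((g⁻¹ : G∞) : Mat)) = adConjGL g := rfl

/-- **`L_u R_v (α(g ·)) = (L_{Ad(g) u} R_v α)(g ·)`.** [folklore] -/
theorem archLeftWordDeriv_archRightWordDeriv_comp_mul_left (α : G∞ → ℂ) (g : G∞) (u v : List Mat) (y : G∞) :
    archLeftWordDeriv u (archRightWordDeriv v (fun h => α (g * h))) y =
      archLeftWordDeriv (u.map (adConjGL g)) (archRightWordDeriv v α) (g * y) := by
  rw [archRightWordDeriv_comp_mul_left α g v, archLeftWordDeriv_comp_mul_left, adConjGL_eq]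

end Words

/-! ### 2. `T ∘ λ(w)` is a distribution -/

section Distribution

variable (T : ↥(archTestFunctions n K) →ₗ[ℂ] ℂ)

/-- The support of `λ(w) f` is `w · tsupport f`. [folklore] -/
theorem tsupport_leftTranslate_subset (w : G∞) (f : ↥(archTestFunctions n K)) :
    tsupport ((archTestFunctions.leftTranslate w f : ↥(archTestFunctions n K)) : G∞ → ℂ) ⊆
      (fun x => w * x) '' tsupport (f : G∞ → ℂ) := by
  have h : ((archTestFunctions.leftTranslate w f : ↥(archTestFunctions n K)) : G∞ → ℂ) =
      (f : G∞ → ℂ) ∘ (Homeomorph.mulLeft w⁻¹) := by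
    funext x; simp [archTestFunctions.leftTranslate_apply]
  rw [h, tsupport_comp_eq_preimage]
  intro x hx
  exact ⟨w⁻¹ * x, hx, by simp⟩

/-- **`T ∘ λ(w)` is a distribution when `T` is.** [folklore] -/
theorem isArchDistribution_comp_leftTranslate (hT : IsArchDistribution n K T) (w : G∞) :
    IsArchDistribution n K (T.comp (archTestFunctions.leftTranslate w)) := by
  intro κ hκ
  obtain ⟨C, 𝒮, hC, hbd⟩ := hT ((fun x => w * x) '' κ) (hκ.image (continuous_const.mul continuous_id))
  refine ⟨C, 𝒮.image fun p => (p.1.map (adConjGL w⁻¹), p.2), hC, ?_⟩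
  intro f hfκ M hM
  rw [LinearMap.comp_apply]
  refine hbd (archTestFunctions.leftTranslate w f) ((tsupport_leftTranslate_subset w f).trans (image_mono hfκ)) M ?_
  intro p hp y
  have hp' : (p.1.map (adConjGL w⁻¹), p.2) ∈ 𝒮.image fun p => (p.1.map (adConjGL w⁻¹), p.2) := Finset.mem_image_of_mem _ hp
  have h := hM _ hp' (w⁻¹ * y)
  rw [show ((archTestFunctions.leftTranslate w f : ↥(archTestFunctions n K)) : G∞ → ℂ) = fun h => (f : G∞ → ℂ) (w⁻¹ * h)
    from rfl, archLeftWordDeriv_archRightWordDeriv_comp_mul_left]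
  exact h

end Distribution

/-! ### 3. Invariant derivatives and translations -/

section Commute

/-- `λ(w)` and `ρ(u)` commute. [folklore] -/
theorem leftTranslate_rightTranslate_comm (w u : G∞) (f : ↥(archTestFunctions n K)) :
    archTestFunctions.leftTranslate w (archTestFunctions.rightTranslate u f) =
      archTestFunctions.rightTranslate u (archTestFunctions.leftTranslate w f) := by
  apply Subtype.ext; funext x
  simp [archTestFunctions.leftTranslate_apply, archTestFunctions.rightTranslate_apply, mul_assoc]

/-- **`R_X λ(w) = λ(w) R_X`.** [folklore] -/
theorem rightDeriv_leftTranslate (X : Mat) (w : G∞) (f : ↥(archTestFunctions n K)) :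
    archTestFunctions.rightDeriv X (archTestFunctions.leftTranslate w f) =
      archTestFunctions.leftTranslate w (archTestFunctions.rightDeriv X f) := by
  apply Subtype.ext; funext y
  change archRightDeriv X (fun h => (f : G∞ → ℂ) (w⁻¹ * h)) y = archRightDeriv X (f : G∞ → ℂ) (w⁻¹ * y)
  exact archRightDeriv_comp_mul_left X _ w⁻¹ y

/-- **`L_X λ(w) = λ(w) L_{w⁻¹ X w}`.** [folklore] -/
theorem leftDeriv_leftTranslate (X : Mat) (w : G∞) (f : ↥(archTestFunctions n K)) :
    archTestFunctions.leftDeriv X (archTestFunctions.leftTranslate w f) =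
      archTestFunctions.leftTranslate w (archTestFunctions.leftDeriv (adConjGL w⁻¹ X) f) := by
  apply Subtype.ext; funext y
  change archLeftDeriv X (fun h => (f : G∞ → ℂ) (w⁻¹ * h)) y = archLeftDeriv (adConjGL w⁻¹ X) (f : G∞ → ℂ) (w⁻¹ * y)
  rw [archLeftDeriv_comp_mul_left, adConjGL_apply]

/-- `λ(w) L_Y = L_{w Y w⁻¹} λ(w)`. [folklore] -/
theorem leftTranslate_leftDeriv (Y : Mat) (w : G∞) (f : ↥(archTestFunctions n K)) :
    archTestFunctions.leftTranslate w (archTestFunctions.leftDeriv Y f) =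
      archTestFunctions.leftDeriv (adConjGL w Y) (archTestFunctions.leftTranslate w f) := by
  rw [leftDeriv_leftTranslate, adConjGL_inv_adConjGL]

/-- The real-place right Casimir operator commutes with `λ(w)`. [folklore] -/
theorem placeCasimirRealR_leftTranslate (v : {v : InfinitePlace K // IsReal v}) (w : G∞) (f : ↥(archTestFunctions n K)) :
    archTestFunctions.placeCasimirRealR v (archTestFunctions.leftTranslate w f) =
      archTestFunctions.leftTranslate w (archTestFunctions.placeCasimirRealR v f) := by
  simp only [archTestFunctions.placeCasimirRealR, LinearMap.sum_apply, LinearMap.comp_apply, rightDeriv_leftTranslate, _root_.map_sum]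

/-- The right hol letters commute with `λ(w)`. [folklore] -/
theorem holDerivR_leftTranslate (v : {v : InfinitePlace K // IsComplex v}) (i j : Fin n) (w : G∞) (f : ↥(archTestFunctions n K)) :
    archTestFunctions.holDerivR v i j (archTestFunctions.leftTranslate w f) =
      archTestFunctions.leftTranslate w (archTestFunctions.holDerivR v i j f) := by
  simp only [archTestFunctions.holDerivR, LinearMap.sub_apply, LinearMap.smul_apply, rightDeriv_leftTranslate, map_sub, map_smul]

/-- The right anti letters commute with `λ(w)`. [folklore] -/
theorem antiDerivR_leftTranslate (v : {v : InfinitePlace K // IsComplex v}) (i j : Fin n) (w : G∞) (f : ↥(archTestFunctions n K)) :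
    archTestFunctions.antiDerivR v i j (archTestFunctions.leftTranslate w f) =
      archTestFunctions.leftTranslate w (archTestFunctions.antiDerivR v i j f) := by
  simp only [archTestFunctions.antiDerivR, LinearMap.add_apply, LinearMap.smul_apply, rightDeriv_leftTranslate, map_add, map_smul]

/-- The complex-place right hol Casimir operator commutes with `λ(w)`. [folklore] -/
theorem placeCasimirHolR_leftTranslate (v : {v : InfinitePlace K // IsComplex v}) (w : G∞) (f : ↥(archTestFunctions n K)) :
    archTestFunctions.placeCasimirHolR v (archTestFunctions.leftTranslate w f) =
      archTestFunctions.leftTranslate w (archTestFunctions.placeCasimirHolR v f) := by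
  simp only [archTestFunctions.placeCasimirHolR, LinearMap.sum_apply, LinearMap.comp_apply, holDerivR_leftTranslate, _root_.map_sum]

/-- The complex-place right anti Casimir operator commutes with `λ(w)`. [folklore] -/
theorem placeCasimirAntiR_leftTranslate (v : {v : InfinitePlace K // IsComplex v}) (w : G∞) (f : ↥(archTestFunctions n K)) :
    archTestFunctions.placeCasimirAntiR v (archTestFunctions.leftTranslate w f) =
      archTestFunctions.leftTranslate w (archTestFunctions.placeCasimirAntiR v f) := by
  simp only [archTestFunctions.placeCasimirAntiR, LinearMap.sum_apply, LinearMap.comp_apply, antiDerivR_leftTranslate, _root_.map_sum]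

end Commute

/-! ### 4. The structure inherited by `T ∘ λ(w)` -/

section Inherit

variable {T : ↥(archTestFunctions n K) →ₗ[ℂ] ℂ}

/-- **`T ∘ λ(w)` is a Casimir eigendistribution when `T` is** (the Casimir operators are bi-invariant).
[cite: Shalika1974, §2] -/
theorem IsArchCasimirEigendistribution.comp_leftTranslate (hC : IsArchCasimirEigendistribution n K T) (w : G∞) :
    IsArchCasimirEigendistribution n K (T.comp (archTestFunctions.leftTranslate w)) := by
  obtain ⟨hRe, hHo, hAn⟩ := hC
  refine ⟨fun v => ?_, fun v => ?_, fun v => ?_⟩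
  · obtain ⟨c, hc⟩ := hRe v
    refine ⟨c, fun f => ?_⟩
    simp only [LinearMap.comp_apply]
    rw [archTestFunctions.placeCasimirReal_eq_right, ← placeCasimirRealR_leftTranslate, ← archTestFunctions.placeCasimirReal_eq_right, hc]
  · obtain ⟨c, hc⟩ := hHo v
    refine ⟨c, fun f => ?_⟩
    simp only [LinearMap.comp_apply]
    rw [archTestFunctions.placeCasimirHol_eq_right, ← placeCasimirHolR_leftTranslate, ← archTestFunctions.placeCasimirHol_eq_right, hc]
  · obtain ⟨c, hc⟩ := hAn v
    refine ⟨c, fun f => ?_⟩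
    simp only [LinearMap.comp_apply]
    rw [archTestFunctions.placeCasimirAnti_eq_right, ← placeCasimirAntiR_leftTranslate, ← archTestFunctions.placeCasimirAnti_eq_right, hc]

/-- **Right quasi-invariance is inherited by `T ∘ λ(w)`.** [folklore] -/
theorem apply_rightTranslate_comp_leftTranslate
    (hR : ∀ (u : ↥(upperUnitriangular (Fin n) (mixedSpace K))) (f : ↥(archTestFunctions n K)),
      T (archTestFunctions.rightTranslate (u : G∞) f) = (archWhittakerChar n K u)⁻¹ * T f)
    (w : G∞) (u : ↥(upperUnitriangular (Fin n) (mixedSpace K))) (f : ↥(archTestFunctions n K)) :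
    (T.comp (archTestFunctions.leftTranslate w)) (archTestFunctions.rightTranslate (u : G∞) f) =
      (archWhittakerChar n K u)⁻¹ * (T.comp (archTestFunctions.leftTranslate w)) f := by
  simp only [LinearMap.comp_apply]
  rw [leftTranslate_rightTranslate_comm, hR]

/-- **The right root equations of `T ∘ λ(w)`**: `(T ∘ λ(w))(R_{x E_{ij}} f) = -ψ'_∞(x E_{ij}) · (T ∘ λ(w)) f`
for `i < j`. [cite: Shalika1974, §2] -/
theorem apply_rightDeriv_comp_leftTranslate (hT : IsArchDistribution n K T)
    (hR : ∀ (u : ↥(upperUnitriangular (Fin n) (mixedSpace K))) (f : ↥(archTestFunctions n K)),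
      T (archTestFunctions.rightTranslate (u : G∞) f) = (archWhittakerChar n K u)⁻¹ * T f)
    (w : G∞) {i j : Fin n} (hij : i < j) (x : R∞) (f : ↥(archTestFunctions n K)) :
    (T.comp (archTestFunctions.leftTranslate w)) (archTestFunctions.rightDeriv (Matrix.single i j x) f) =
      -archWhittakerDChar K i j x * (T.comp (archTestFunctions.leftTranslate w)) f :=
  (isArchDistribution_comp_leftTranslate T hT w).apply_rightDeriv_single_of_rightQuasiInvariant
    (apply_rightTranslate_comp_leftTranslate hR w) hij x f

/-- **The left root equations of `T ∘ λ(w)`**: if `w Y w⁻¹ = x E_{ij}` with `i < j` and `T` is left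
`(N, ψ_∞)`-quasi-invariant, then `(T ∘ λ(w))(L_Y f) = ψ'_∞(x E_{ij}) · (T ∘ λ(w)) f`. [cite: Shalika1974, §2] -/
theorem apply_leftDeriv_comp_leftTranslate (hT : IsArchDistribution n K T)
    (hL : ∀ (u : ↥(upperUnitriangular (Fin n) (mixedSpace K))) (f : ↥(archTestFunctions n K)),
      T (archTestFunctions.leftTranslate (u : G∞) f) = archWhittakerChar n K u * T f)
    (w : G∞) {Y : Mat} {i j : Fin n} (hij : i < j) {x : R∞} (hY : adConjGL w Y = Matrix.single i j x)
    (f : ↥(archTestFunctions n K)) :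
    (T.comp (archTestFunctions.leftTranslate w)) (archTestFunctions.leftDeriv Y f) =
      archWhittakerDChar K i j x * (T.comp (archTestFunctions.leftTranslate w)) f := by
  simp only [LinearMap.comp_apply]
  rw [leftTranslate_leftDeriv, hY]
  exact hT.apply_leftDeriv_single_of_leftQuasiInvariant hL hij x _

end Inherit

end Literature.NumberTheory.Automorphic
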